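import Literature.NumberTheory.LFunctions.DirichletLFunctionInverseBound
import HarnessLib

/-!
# `1/L(s, χ)` near `σ = 1`: Montgomery–Vaughan (11.10) in its sharp additive form, and the
# lower bound `|L(1+2it, χ)| ≫ min(|t|, 1/log q)` at the Siegel point

Topic `Literature/NumberTheory/LFunctions` (namespace `Literature.NumberTheory.LFunctions.DirichletZFR`,
corollary in `…LFunctions.SiegelPoint`). PROOFS only (no named fact, no definition).

The tree's `DirichletZFR.exists_inv_LFunction_bounds` (`DirichletLFunctionInverseBound.lean`) proves
MV Theorem 11.4 (11.7)/(11.10) with clause (B) in the form `‖1/L(s,χ)‖ ≤ C ℒ (1 + 1/‖s − β₁‖)`,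
which loses a factor `ℒ` against the printed statement in the range `‖s − β₁‖ ≤ 1`
((11.10): `|s − β₁| ≪ |L(s,χ)|` for `|s − β₁| ≤ 1/log q`; (11.7): `1/L ≪ log qτ` for
`|s − β₁| ≥ 1/log q`). Re-running the same Grönwall argument with the triangle inequality
`|s₁ − β₁| ≤ |s₁ − s| + |s − β₁| ≤ 1/ℒ + |s − β₁|` (instead of `|s₁ − s| ≤ 1`) gives the printed
sharpness in the ADDITIVE form `‖1/L(s,χ)‖ ≤ C (ℒ + 1/‖s − β₁‖)`
(`exists_inv_LFunction_bounds_sharp`). On the segment `s = 1 + 2it`, `0 < |t| ≤ 1` this is the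
lower bound `|L(1 + 2it, χ)| ≥ c · min(|t|, 1/log q)` (`SiegelPoint.siegelPointLowerBound`) — the
P1 / K0 `SiegelPointLowerBound` of the §D fam card `siegel-point-annihilation` (cell `landau-siegel`),
VERBATIM, now a kernel theorem (its `|t|/log q` weakening `SiegelPoint.norm_LFunction_one_add_ge`
and the neutralisation rung are in `SiegelPointNeutralisation.lean`).

«The programme SEARCHES and TYPES; no claim about Landau–Siegel zeros, Theorems 1–2 of
arXiv:2211.02515 or a repaired Margin232 until a kernel theorem says so.»

## References

* [MontgomeryVaughan2007] H. L. Montgomery, R. C. Vaughan, *Multiplicative Number Theory I*,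
  CUP (2007), §11.1 Theorem 11.4, (11.7), (11.10) and proof pp. 277–278 (held p0277:L39–L60,
  p0278:L13–L45, read 2026-08-27).
* [Titchmarsh1986] E. C. Titchmarsh, *The Theory of the Riemann Zeta-Function*, 2nd ed., §3.9
  (3.11.6)–(3.11.8) — the Grönwall step (tree: `norm_le_norm_mul_exp_of_deriv_le`).
-/

noncomputable section

open Complex Filter Topology Metric Set Finset

namespace Literature.NumberTheory.LFunctions.DirichletZFR

set_option maxHeartbeats 800000 in
/-- **Montgomery–Vaughan Theorem 11.4, (11.7) and (11.10), with (11.10) in its SHARP (additive)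
form.** There are absolute constants `c > 0`, `C > 0` such that for every `q ≥ 1` and every
non-principal `χ` mod `q` (`ℒ = log q + log(|t| + 4)`, `ℒ₀ = log q + log 4`):
(A) if `L(s, χ)` has no real zero `β > 1 − 2c/ℒ₀`, then for `σ ≥ 1 − c/ℒ`: `L(s, χ) ≠ 0` and
`‖1/L(s, χ)‖ ≤ C ℒ` — (11.7);
(B) if `β > 1 − 2c/ℒ₀` is a real zero, then for `σ ≥ 1 − c/ℒ`, `s ≠ β`: `L(s, χ) ≠ 0` and
`‖1/L(s, χ)‖ ≤ C (ℒ + 1/‖s − β‖)`, i.e. `|L(s,χ)| ≫ min(|s − β₁|, 1/ℒ)`: (11.10)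
`|s − β₁| ≪ |L(s, χ)|` for `|s − β₁| ≤ 1/log q` AND (11.7) `1/L ≪ ℒ` for `|s − β₁| ≥ 1/log q`,
both sharp. Same proof as the tree's `exists_inv_LFunction_bounds` (Grönwall for
`g(s) = L(s, χ)/(s − β)` along `[σ, 1 + 1/(8ℒ)] + it`), keeping `|s₁ − s| ≤ 1/ℒ` in the triangle
inequality `|s₁ − β| ≤ |s₁ − s| + |s − β|` instead of `|s₁ − s| ≤ 1` (which gave the lossy
`C ℒ (1 + 1/‖s − β‖)` there). [cite: MontgomeryVaughan2007, Theorem 11.4 (11.7) and (11.10)] -/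
theorem exists_inv_LFunction_bounds_sharp :
    ∃ c : ℝ, 0 < c ∧ ∃ C : ℝ, 0 < C ∧
      (∀ (q : ℕ) [NeZero q] (χ : DirichletCharacter ℂ q), χ ≠ 1 →
        (∀ β : ℝ, χ.LFunction β = 0 → β ≤ 1 - 2 * c / (Real.log q + Real.log 4)) →
        ∀ s : ℂ, 1 - c / (Real.log q + Real.log (|s.im| + 4)) ≤ s.re →
          χ.LFunction s ≠ 0 ∧
          ‖(χ.LFunction s)⁻¹‖ ≤ C * (Real.log q + Real.log (|s.im| + 4))) ∧
      (∀ (q : ℕ) [NeZero q] (χ : DirichletCharacter ℂ q), χ ≠ 1 → ∀ β : ℝ,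
        χ.LFunction β = 0 → 1 - 2 * c / (Real.log q + Real.log 4) < β →
        ∀ s : ℂ, 1 - c / (Real.log q + Real.log (|s.im| + 4)) ≤ s.re → s ≠ β →
          χ.LFunction s ≠ 0 ∧
          ‖(χ.LFunction s)⁻¹‖ ≤
            C * ((Real.log q + Real.log (|s.im| + 4)) + ‖s - β‖⁻¹)) := by
  obtain ⟨c, hcpos, hc40, C, hC0, -, -, -, hA, hB⟩ :=
    exists_norm_logDeriv_sub_polar_le
  -- constants: `c' = c/2`, `K = C + 2/c`, `C' = 9 exp(K(1/8 + c))`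
  set K : ℝ := C + 2 / c with hKdef
  have hK0 : 0 ≤ K := by positivity
  set κ₀ : ℝ := K * (1 / 8 + c) with hκ₀
  set C' : ℝ := 9 * Real.exp κ₀ with hC'def
  have hexp1 : 1 ≤ Real.exp κ₀ := Real.one_le_exp (by positivity)
  have hC'9 : 9 ≤ C' := by rw [hC'def]; nlinarith
  have hC'0 : 0 ≤ C' := by linarith
  refine ⟨c / 2, by positivity, C', by linarith, ?_, ?_⟩
  · -- (A)
    intro q _ χ hχ hnone s hs
    obtain ⟨σ, hσdef⟩ : ∃ σ : ℝ, s.re = σ := ⟨_, rfl⟩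
    obtain ⟨t, htdef⟩ : ∃ t : ℝ, s.im = t := ⟨_, rfl⟩
    have hseq : s = σ + t * I := by
      rw [← hσdef, ← htdef]; exact (Complex.re_add_im s).symm.trans (by simp [mul_comm])
    rw [htdef]
    rw [hσdef, htdef] at hs
    set ℒ : ℝ := Real.log q + Real.log (|t| + 4) with hℒ
    set ℒ₀ : ℝ := Real.log q + Real.log 4 with hℒ₀
    have hℒ1 : 1 ≤ ℒ := one_le_ell q t
    have hℒ0 : 0 < ℒ := by linarith
    have hℒ₀1 : 1 ≤ ℒ₀ := PagePNT.one_le_ell0 q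
    have hℒ₀0 : 0 < ℒ₀ := by linarith
    have hℒ₀ℒ : ℒ₀ ≤ ℒ := by
      rw [hℒ₀, hℒ]
      have : Real.log 4 ≤ Real.log (|t| + 4) :=
        Real.log_le_log (by norm_num) (by linarith [abs_nonneg t])
      linarith
    -- the log-derivative bound `‖L'/L(u + it)‖ ≤ K ℒ` for `u ≥ σ`
    have hld : ∀ u : ℝ, σ ≤ u → χ.LFunction (u + t * I) ≠ 0 ∧
        ‖deriv χ.LFunction (u + t * I)‖ ≤ K * ℒ * ‖χ.LFunction (u + t * I)‖ := by
      intro u hu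
      have hure : ((u : ℂ) + t * I).re = u := by simp
      have huim : ((u : ℂ) + t * I).im = t := by simp
      have hureg : 1 - c / (Real.log q + Real.log (|((u : ℂ) + t * I).im| + 4)) ≤
          ((u : ℂ) + t * I).re := by
        rw [hure, huim]
        have : c / 2 / ℒ ≤ c / ℒ := div_le_div_of_nonneg_right (by linarith) hℒ0.le
        linarith
      -- either no zero right of `1 − 2c/ℒ₀`, or one zero `β₂ ∈ (1 − 2c/ℒ₀, 1 − c/ℒ₀]`
      have hbound : χ.LFunction (u + t * I) ≠ 0 ∧
          ‖deriv χ.LFunction (u + t * I) / χ.LFunction (u + t * I)‖ ≤ K * ℒ := by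
        by_cases hex : ∃ β₂ : ℝ, χ.LFunction β₂ = 0 ∧ 1 - 2 * c / ℒ₀ < β₂
        · obtain ⟨β₂, hβ₂, hβ₂c⟩ := hex
          have hβ₂le : β₂ ≤ 1 - 2 * (c / 2) / ℒ₀ := hnone β₂ hβ₂
          have hgap : c / (2 * ℒ₀) ≤ u - β₂ := by
            have h1 : c / 2 / ℒ ≤ c / 2 / ℒ₀ := div_le_div_of_nonneg_left (by linarith) hℒ₀0 hℒ₀ℒ
            have h2 : 2 * (c / 2) / ℒ₀ = c / 2 / ℒ₀ + c / (2 * ℒ₀) := by field_simp; ring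
            linarith
          have hgap0 : 0 < c / (2 * ℒ₀) := by positivity
          have hne : (u : ℂ) + t * I ≠ (β₂ : ℂ) := by
            intro h
            have := congrArg Complex.re h
            simp at this
            linarith
          obtain ⟨hL0, hb⟩ := hB q χ hχ β₂ hβ₂ hβ₂c _ hureg hne
          rw [huim] at hb
          refine ⟨hL0, ?_⟩
          have hpol : ‖1 / ((u : ℂ) + t * I - β₂)‖ ≤ 2 / c * ℒ := by
            have hre : u - β₂ ≤ ‖(u : ℂ) + t * I - β₂‖ := by
              have := Complex.re_le_norm ((u : ℂ) + t * I - β₂)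
              simpa using this
            rw [norm_div, norm_one]
            calc 1 / ‖(u : ℂ) + t * I - β₂‖ ≤ 1 / (c / (2 * ℒ₀)) :=
                  one_div_le_one_div_of_le hgap0 (hgap.trans hre)
              _ = 2 / c * ℒ₀ := by field_simp
              _ ≤ 2 / c * ℒ := mul_le_mul_of_nonneg_left hℒ₀ℒ (by positivity)
          calc ‖deriv χ.LFunction (u + t * I) / χ.LFunction (u + t * I)‖
              = ‖(deriv χ.LFunction (u + t * I) / χ.LFunction (u + t * I) -
                  1 / ((u : ℂ) + t * I - β₂)) + 1 / ((u : ℂ) + t * I - β₂)‖ := by ring_nf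
            _ ≤ ‖deriv χ.LFunction (u + t * I) / χ.LFunction (u + t * I) -
                  1 / ((u : ℂ) + t * I - β₂)‖ + ‖1 / ((u : ℂ) + t * I - β₂)‖ := norm_add_le _ _
            _ ≤ C * ℒ + 2 / c * ℒ := add_le_add hb hpol
            _ = K * ℒ := by rw [hKdef]; ring
        · push Not at hex
          have hnone' : ∀ β : ℝ, χ.LFunction β = 0 → β ≤ 1 - 2 * c / ℒ₀ :=
            fun β hβ ↦ hex β hβ
          obtain ⟨hL0, hb⟩ := hA q χ hχ hnone' _ hureg
          rw [huim] at hb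
          refine ⟨hL0, hb.trans ?_⟩
          have : 0 ≤ 2 / c * ℒ := by positivity
          rw [hKdef]; nlinarith
      obtain ⟨hL0, hb⟩ := hbound
      refine ⟨hL0, ?_⟩
      calc ‖deriv χ.LFunction (u + t * I)‖
          = ‖deriv χ.LFunction (u + t * I) / χ.LFunction (u + t * I)‖ *
              ‖χ.LFunction (u + t * I)‖ := by rw [← norm_mul, div_mul_cancel₀ _ hL0]
        _ ≤ K * ℒ * ‖χ.LFunction (u + t * I)‖ := mul_le_mul_of_nonneg_right hb (norm_nonneg _)
    have hLs : χ.LFunction s ≠ 0 := by rw [hseq]; exact (hld σ le_rfl).1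
    refine ⟨hLs, ?_⟩
    -- the two cases `σ ≥ σ₁` and `σ < σ₁`
    set σ₁ : ℝ := 1 + 1 / (8 * ℒ) with hσ₁
    rcases le_or_gt σ₁ σ with hbig | hsmall
    · have := (norm_inv_LFunction_le_right χ (s := s) hℒ1 (by rw [hσdef]; exact hbig)).2
      exact this.trans (by nlinarith)
    · have hG := norm_le_norm_mul_exp_of_deriv_le (DirichletCharacter.differentiable_LFunction hχ)
        (t := t) (K := K * ℒ) hsmall.le (fun u hu ↦ (hld u hu.1).2)
      -- the exponent
      have hexp : Real.exp (K * ℒ * (σ₁ - σ)) ≤ Real.exp κ₀ := by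
        refine Real.exp_le_exp.2 ?_
        have h1 : σ₁ - σ ≤ (1 / 8 + c) / ℒ := by
          rw [hσ₁]
          have : (1 / 8 + c) / ℒ = 1 / (8 * ℒ) + c / ℒ := by field_simp
          have h2 : c / 2 / ℒ ≤ c / ℒ := div_le_div_of_nonneg_right (by linarith) hℒ0.le
          linarith
        calc K * ℒ * (σ₁ - σ) ≤ K * ℒ * ((1 / 8 + c) / ℒ) :=
              mul_le_mul_of_nonneg_left h1 (by positivity)
          _ = κ₀ := by rw [hκ₀]; field_simp
      -- the lower bound at `σ₁`
      obtain ⟨-, hright⟩ := norm_inv_LFunction_le_right χ (s := (σ₁ : ℂ) + t * I) hℒ1 (by simp [hσ₁])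
      have hL₁0 : χ.LFunction ((σ₁ : ℂ) + t * I) ≠ 0 :=
        DirichletCharacter.LFunction_ne_zero_of_one_le_re χ (Or.inl hχ) (by simp [hσ₁]; positivity)
      have hL₁pos : 0 < ‖χ.LFunction ((σ₁ : ℂ) + t * I)‖ := norm_pos_iff.2 hL₁0
      have hLspos : 0 < ‖χ.LFunction ((σ : ℂ) + t * I)‖ := by
        rw [← hseq]; exact norm_pos_iff.2 hLs
      rw [norm_inv] at hright ⊢
      rw [hseq]
      -- `1/‖L(s)‖ ≤ exp κ₀ / ‖L(s₁)‖ ≤ 9 exp κ₀ ℒ`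
      have h1 : ‖χ.LFunction ((σ₁ : ℂ) + t * I)‖ ≤ ‖χ.LFunction ((σ : ℂ) + t * I)‖ * Real.exp κ₀ :=
        hG.trans (mul_le_mul_of_nonneg_left hexp hLspos.le)
      have h2 : ‖χ.LFunction ((σ : ℂ) + t * I)‖⁻¹ ≤
          Real.exp κ₀ * ‖χ.LFunction ((σ₁ : ℂ) + t * I)‖⁻¹ := by
        rw [inv_le_iff_one_le_mul₀ hLspos]
        calc (1 : ℝ) = ‖χ.LFunction ((σ₁ : ℂ) + t * I)‖ * ‖χ.LFunction ((σ₁ : ℂ) + t * I)‖⁻¹ :=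
              (mul_inv_cancel₀ hL₁pos.ne').symm
          _ ≤ (‖χ.LFunction ((σ : ℂ) + t * I)‖ * Real.exp κ₀) * ‖χ.LFunction ((σ₁ : ℂ) + t * I)‖⁻¹ :=
              mul_le_mul_of_nonneg_right h1 (inv_nonneg.2 (norm_nonneg _))
          _ = Real.exp κ₀ * ‖χ.LFunction ((σ₁ : ℂ) + t * I)‖⁻¹ * ‖χ.LFunction ((σ : ℂ) + t * I)‖ := by
              ring
      calc ‖χ.LFunction ((σ : ℂ) + t * I)‖⁻¹ ≤ Real.exp κ₀ * ‖χ.LFunction ((σ₁ : ℂ) + t * I)‖⁻¹ := h2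
        _ ≤ Real.exp κ₀ * (9 * ℒ) := mul_le_mul_of_nonneg_left hright (Real.exp_pos _).le
        _ = C' * ℒ := by rw [hC'def]; ring
  · -- (B)
    intro q _ χ hχ β hβ hβc'
    have hℒ₀1 : 1 ≤ Real.log q + Real.log 4 := PagePNT.one_le_ell0 q
    set ℒ₀ : ℝ := Real.log q + Real.log 4 with hℒ₀
    have hℒ₀0 : 0 < ℒ₀ := by linarith
    have hβc : 1 - 2 * c / ℒ₀ < β := by
      have : 2 * (c / 2) / ℒ₀ ≤ 2 * c / ℒ₀ := div_le_div_of_nonneg_right (by linarith) hℒ₀0.le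
      linarith
    have hβc1 : 1 - c / ℒ₀ < β := by
      have : 2 * (c / 2) / ℒ₀ = c / ℒ₀ := by ring
      linarith
    have hβ1 : β < 1 := by
      by_contra hcon
      exact DirichletCharacter.LFunction_ne_zero_of_one_le_re χ (Or.inl hχ)
        (s := β) (by simpa using not_lt.1 hcon) hβ
    -- the quotient `g = dslope L β`
    set g : ℂ → ℂ := dslope χ.LFunction (β : ℂ) with hgdef
    have hgd : Differentiable ℂ g := PagePNT.differentiable_dslope_LFunction χ hχ _
    -- `‖g'(w)‖ ≤ C ℒ_w ‖g(w)‖` at points of the region `≠ β`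
    have hgld : ∀ w : ℂ, 1 - c / (Real.log q + Real.log (|w.im| + 4)) ≤ w.re → w ≠ β →
        χ.LFunction w ≠ 0 ∧
        ‖deriv g w‖ ≤ C * (Real.log q + Real.log (|w.im| + 4)) * ‖g w‖ := by
      intro w hw hwβ
      obtain ⟨hL0, hb⟩ := hB q χ hχ β hβ hβc w hw hwβ
      refine ⟨hL0, ?_⟩
      have hg0 : g w ≠ 0 := PagePNT.dslope_ne_zero_of_ne χ hβ hL0
      have heq := PagePNT.logDeriv_LFunction_eq_add χ hχ hβ hL0
      have hquot : deriv g w / g w = deriv χ.LFunction w / χ.LFunction w - 1 / (w - β) := by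
        rw [heq, hgdef]; ring
      calc ‖deriv g w‖ = ‖deriv g w / g w‖ * ‖g w‖ := by rw [← norm_mul, div_mul_cancel₀ _ hg0]
        _ ≤ C * (Real.log q + Real.log (|w.im| + 4)) * ‖g w‖ := by
            rw [hquot]; exact mul_le_mul_of_nonneg_right hb (norm_nonneg _)
    -- the segment bound at height `t`, including the point `β` itself
    have hseg : ∀ (t σ₀ σ₁ : ℝ), 1 - c / (Real.log q + Real.log (|t| + 4)) ≤ σ₀ →
        ((σ₀ : ℂ) + t * I ≠ β ∨ (t = 0 ∧ σ₀ = β)) → σ₀ < σ₁ →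
        ∀ u ∈ Set.Ico σ₀ σ₁, ‖deriv g (u + t * I)‖ ≤
          C * (Real.log q + Real.log (|t| + 4)) * ‖g (u + t * I)‖ := by
      intro t σ₀ σ₁ hσ₀ hstart hσ₀₁ u hu
      have hgen : ∀ v : ℝ, σ₀ ≤ v → (v : ℂ) + t * I ≠ β →
          ‖deriv g (v + t * I)‖ ≤ C * (Real.log q + Real.log (|t| + 4)) * ‖g (v + t * I)‖ := by
        intro v hv hvβ
        have h := (hgld ((v : ℂ) + t * I) (by simpa using hσ₀.trans hv) hvβ).2
        simpa using h
      by_cases huβ : (u : ℂ) + t * I = β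
      · -- then `t = 0`, `u = β`: pass to the limit from the right
        have ht : t = 0 := by
          have := congrArg Complex.im huβ; simpa using this
        have huβ' : u = β := by
          have := congrArg Complex.re huβ; simpa using this
        subst huβ'
        refine deriv_le_at_left_of_Ioo hgd (σ₁ := σ₁) hu.2 fun v hv ↦ hgen v (hu.1.trans hv.1.le) ?_
        intro h
        have := congrArg Complex.re h
        simp at this
        linarith [hv.1]
      · exact hgen u hu.1 huβ
    intro s hs hsβ
    obtain ⟨σ, hσdef⟩ : ∃ σ : ℝ, s.re = σ := ⟨_, rfl⟩
    obtain ⟨t, htdef⟩ : ∃ t : ℝ, s.im = t := ⟨_, rfl⟩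
    have hseq : s = σ + t * I := by
      rw [← hσdef, ← htdef]; exact (Complex.re_add_im s).symm.trans (by simp [mul_comm])
    rw [htdef]
    rw [hσdef, htdef] at hs
    set ℒ : ℝ := Real.log q + Real.log (|t| + 4) with hℒ
    have hℒ1 : 1 ≤ ℒ := one_le_ell q t
    have hℒ0 : 0 < ℒ := by linarith
    have hsreg : 1 - c / ℒ ≤ σ := by
      have : c / 2 / ℒ ≤ c / ℒ := div_le_div_of_nonneg_right (by linarith) hℒ0.le
      linarith
    have hLs : χ.LFunction s ≠ 0 :=
      (hgld s (by rw [hσdef, htdef]; exact hsreg) hsβ).1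
    refine ⟨hLs, ?_⟩
    have hsβpos : 0 < ‖s - β‖ := norm_pos_iff.2 (sub_ne_zero.2 hsβ)
    have hfac1 : 1 ≤ 1 + ‖s - (β : ℂ)‖⁻¹ := by
      have := inv_nonneg.2 hsβpos.le; linarith
    set σ₁ : ℝ := 1 + 1 / (8 * ℒ) with hσ₁
    have hκ : 0 < 1 / (8 * ℒ) := by positivity
    have hκ1 : 1 / (8 * ℒ) ≤ 1 / 8 := by
      rw [div_le_div_iff₀ (by positivity) (by norm_num)]; linarith
    rcases le_or_gt σ₁ σ with hbig | hsmall
    · have := (norm_inv_LFunction_le_right χ (s := s) hℒ1 (by rw [hσdef]; exact hbig)).2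
      have hinv0 : 0 ≤ ‖s - (β : ℂ)‖⁻¹ := inv_nonneg.2 hsβpos.le
      calc ‖(χ.LFunction s)⁻¹‖ ≤ 9 * ℒ := this
        _ ≤ C' * ℒ := by nlinarith
        _ ≤ C' * (ℒ + ‖s - (β : ℂ)‖⁻¹) := by nlinarith
    · -- Grönwall for `g` on `[σ, σ₁] + it`
      have hstart : ((σ : ℂ) + t * I ≠ β ∨ (t = 0 ∧ σ = β)) := Or.inl (by rw [← hseq]; exact hsβ)
      have hG := norm_le_norm_mul_exp_of_deriv_le hgd (t := t) (K := C * ℒ) hsmall.le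
        (hseg t σ σ₁ hsreg hstart hsmall)
      have hexp : Real.exp (C * ℒ * (σ₁ - σ)) ≤ Real.exp κ₀ := by
        refine Real.exp_le_exp.2 ?_
        have h1 : σ₁ - σ ≤ (1 / 8 + c) / ℒ := by
          have : (1 / 8 + c) / ℒ = 1 / (8 * ℒ) + c / ℒ := by field_simp
          rw [this, hσ₁]; linarith
        calc C * ℒ * (σ₁ - σ) ≤ C * ℒ * ((1 / 8 + c) / ℒ) :=
              mul_le_mul_of_nonneg_left h1 (by positivity)
          _ = C * (1 / 8 + c) := by field_simp
          _ ≤ κ₀ := by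
              rw [hκ₀, hKdef]
              have : 0 ≤ 2 / c * (1 / 8 + c) := by positivity
              nlinarith
      set s₁ : ℂ := (σ₁ : ℂ) + t * I with hs₁
      obtain ⟨hL₁0, hright⟩ := norm_inv_LFunction_le_right χ (s := s₁) hℒ1 (by simp [hs₁, hσ₁])
      have hs₁β : s₁ - β ≠ 0 := by
        intro h
        have := congrArg Complex.re h
        simp [hs₁] at this
        linarith
      have hgs₁ : g s₁ = χ.LFunction s₁ / (s₁ - β) := by
        have h := PagePNT.LFunction_eq_mul_dslope χ hβ s₁
        rw [hgdef, h]; field_simp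
      have hgs : χ.LFunction s = (s - β) * g s := by
        rw [hgdef]; exact PagePNT.LFunction_eq_mul_dslope χ hβ s
      have hL₁pos : 0 < ‖χ.LFunction s₁‖ := norm_pos_iff.2 hL₁0
      have hs₁βpos : 0 < ‖s₁ - β‖ := norm_pos_iff.2 hs₁β
      have hgs₁pos : 0 < ‖g s₁‖ := by rw [hgs₁, norm_div]; exact div_pos hL₁pos hs₁βpos
      have hgspos : 0 < ‖g s‖ := by
        have := norm_pos_iff.2 hLs
        rw [hgs, norm_mul] at this
        exact pos_of_mul_pos_right this (norm_nonneg _)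
      rw [← hseq] at hG
      -- `‖s₁ − β‖ ≤ ‖s₁ − s‖ + ‖s − β‖ ≤ 1 + ‖s − β‖`
      -- SHARP STEP: `‖s₁ − s‖ = σ₁ − σ ≤ (1/8 + c)/ℒ ≤ 1/ℒ` (not merely `≤ 1`)
      have hA1 : 1 / 8 + c ≤ 1 := by linarith
      have hs₁s : ‖s₁ - s‖ ≤ 1 / ℒ := by
        have : s₁ - s = ((σ₁ - σ : ℝ) : ℂ) := by rw [hs₁, hseq]; push_cast; ring
        rw [this, Complex.norm_real, Real.norm_of_nonneg (by linarith)]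
        have h1 : σ₁ - σ ≤ (1 / 8 + c) / ℒ := by
          have : (1 / 8 + c) / ℒ = 1 / (8 * ℒ) + c / ℒ := by field_simp
          rw [this, hσ₁]; linarith
        exact h1.trans (div_le_div_of_nonneg_right hA1 hℒ0.le)
      have htri : ‖s₁ - (β : ℂ)‖ ≤ 1 / ℒ + ‖s - β‖ := by
        calc ‖s₁ - (β : ℂ)‖ = ‖(s₁ - s) + (s - β)‖ := by ring_nf
          _ ≤ ‖s₁ - s‖ + ‖s - β‖ := norm_add_le _ _
          _ ≤ 1 / ℒ + ‖s - β‖ := by linarith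
      -- assemble: `1/‖L s‖ = 1/(‖s-β‖ ‖g s‖) ≤ exp κ₀/(‖s-β‖ ‖g s₁‖) = exp κ₀ ‖s₁-β‖/(‖s-β‖ ‖L s₁‖)`
      rw [norm_inv] at hright ⊢
      rw [inv_le_iff_one_le_mul₀ (norm_pos_iff.2 hLs)]
      have h1 : 1 ≤ 9 * ℒ * ‖χ.LFunction s₁‖ := by
        have := (inv_le_iff_one_le_mul₀ hL₁pos).1 hright
        linarith
      have h2 : ‖χ.LFunction s₁‖ = ‖s₁ - β‖ * ‖g s₁‖ := by
        rw [hgs₁, norm_div, mul_div_cancel₀ _ hs₁βpos.ne']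
      have h3 : ‖g s₁‖ ≤ ‖g s‖ * Real.exp κ₀ :=
        hG.trans (mul_le_mul_of_nonneg_left hexp hgspos.le)
      have h4 : ‖g s‖ = ‖χ.LFunction s‖ / ‖s - β‖ := by
        rw [hgs, norm_mul, mul_div_cancel_left₀ _ hsβpos.ne']
      calc (1 : ℝ) ≤ 9 * ℒ * ‖χ.LFunction s₁‖ := h1
        _ = 9 * ℒ * (‖s₁ - β‖ * ‖g s₁‖) := by rw [h2]
        _ ≤ 9 * ℒ * ((1 / ℒ + ‖s - β‖) * (‖g s‖ * Real.exp κ₀)) := by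
            refine mul_le_mul_of_nonneg_left ?_ (by positivity)
            exact mul_le_mul htri h3 hgs₁pos.le (by positivity)
        _ = C' * ((1 + ℒ * ‖s - β‖) / ‖s - β‖) * ‖χ.LFunction s‖ := by
            rw [h4, hC'def]; field_simp
        _ = C' * (ℒ + ‖s - (β : ℂ)‖⁻¹) * ‖χ.LFunction s‖ := by
            congr 2
            field_simp
            ring

end Literature.NumberTheory.LFunctions.DirichletZFR

namespace Literature.NumberTheory.LFunctions.SiegelPoint

/-- `log q + log(|2t| + 4) ≤ 4 log q` for `q ≥ 2`, `|t| ≤ 1`. [cite: MontgomeryVaughan2007, Theorem 11.4 (notation ℒ = log qτ)] -/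
private theorem ell_le_four_log' {q : ℕ} (hq : 2 ≤ q) {t : ℝ} (ht : |t| ≤ 1) :
    Real.log q + Real.log (|2 * t| + 4) ≤ 4 * Real.log q := by
  have hq' : (2 : ℝ) ≤ q := by exact_mod_cast hq
  have hlog2 : Real.log 2 ≤ Real.log q := Real.log_le_log (by norm_num) hq'
  have h6 : |2 * t| + 4 ≤ 8 := by
    rw [abs_mul, abs_of_pos (by norm_num : (0:ℝ) < 2)]; linarith
  have hl6 : Real.log (|2 * t| + 4) ≤ Real.log 8 := Real.log_le_log (by positivity) h6
  have hl8 : Real.log 8 = 3 * Real.log 2 := by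
    rw [show (8 : ℝ) = 2 ^ 3 by norm_num, Real.log_pow]; norm_num
  linarith

/-- **P1 / K0 of the card `siegel-point-annihilation`, verbatim, PROVED (MV Theorem 11.4 on the
line `σ = 1` at the Siegel point).** There is an absolute `c > 0` such that for every `q ≥ 2`,
every non-principal `χ mod q` and every real `t` with `0 < |t| ≤ 1`:
`c · min(|t|, 1/log q) ≤ ‖L(1 + 2it, χ)‖`. From `exists_inv_LFunction_bounds_sharp`: case (A)
`‖1/L‖ ≤ C ℒ ≤ 4C log q`; case (B) `‖1/L‖ ≤ C(ℒ + 1/‖s − β₁‖) ≤ C(4 log q + 1/(2|t|))`; in both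
cases `‖1/L‖ ≤ 5C / min(|t|, 1/log q)`. The possible exceptional zero only degrades the bound
inside `|t| ≲ 1/log q`, linearly in `|t|`; no lower bound for `L(1,χ)` is used (effective).
[cite: MontgomeryVaughan2007, Theorem 11.4 (11.7) and (11.10)] -/
theorem siegelPointLowerBound :
    ∃ c : ℝ, 0 < c ∧ ∀ (q : ℕ) [NeZero q], 2 ≤ q → ∀ χ : DirichletCharacter ℂ q, χ ≠ 1 →
      ∀ t : ℝ, 0 < |t| → |t| ≤ 1 →
        c * min |t| (1 / Real.log q) ≤ ‖DirichletCharacter.LFunction χ (1 + 2 * t * I)‖ := by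
  obtain ⟨c, hc, C, hC, hA, hB⟩ := DirichletZFR.exists_inv_LFunction_bounds_sharp
  refine ⟨(5 * C)⁻¹, by positivity, fun q _ hq χ hχ t ht0 ht1 => ?_⟩
  have hq1 : 1 ≤ q := le_trans (by norm_num) hq
  have hlogq : 0 < Real.log q := Real.log_pos (by exact_mod_cast (lt_of_lt_of_le one_lt_two hq))
  set M : ℝ := min |t| (1 / Real.log q) with hM
  have hM1 : M ≤ |t| := min_le_left _ _
  have hM2 : M ≤ 1 / Real.log q := min_le_right _ _
  have hMpos : 0 < M := lt_min ht0 (by positivity)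
  set s : ℂ := 1 + 2 * t * I with hs
  have hsre : s.re = 1 := by simp [hs]
  have hsim : s.im = 2 * t := by simp [hs]
  have hL : 0 < Real.log q + Real.log (|s.im| + 4) := by
    rw [hsim]
    have h1 : 0 ≤ Real.log q := Real.log_nonneg (by exact_mod_cast hq1)
    have h2 : 0 < Real.log (|2 * t| + 4) := Real.log_pos (by linarith [abs_nonneg (2 * t)])
    linarith
  have hL4 : Real.log q + Real.log (|s.im| + 4) ≤ 4 * Real.log q := by
    rw [hsim]; exact ell_le_four_log' hq ht1
  have hreg : 1 - c / (Real.log q + Real.log (|s.im| + 4)) ≤ s.re := by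
    rw [hsre]; have : 0 < c / (Real.log q + Real.log (|s.im| + 4)) := div_pos hc hL; linarith
  -- `4 log q ≤ 4/M` and `1/(2|t|) ≤ 1/M`
  have hlogM : Real.log q ≤ 1 / M := by
    have h := one_div_le_one_div_of_le hMpos hM2
    rwa [one_div_one_div] at h
  have htM : (2 * |t|)⁻¹ ≤ 1 / M := by
    rw [one_div]
    exact inv_anti₀ hMpos (by linarith)
  -- the bound `‖L⁻¹‖ ≤ 5C/M` in both cases
  have key : χ.LFunction s ≠ 0 ∧ ‖(χ.LFunction s)⁻¹‖ ≤ 5 * C / M := by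
    by_cases hex : ∃ β : ℝ, χ.LFunction β = 0 ∧ 1 - 2 * c / (Real.log q + Real.log 4) < β
    · obtain ⟨β, hβ0, hβ⟩ := hex
      have hsβ : s ≠ (β : ℂ) := by
        intro h
        have := congrArg Complex.im h
        rw [hsim, Complex.ofReal_im] at this
        have : t = 0 := by linarith
        exact (ne_of_gt ht0) (by rw [this, abs_zero])
      obtain ⟨hne, hle⟩ := hB q χ hχ β hβ0 hβ s hreg hsβ
      refine ⟨hne, le_trans hle ?_⟩
      have hdist : 2 * |t| ≤ ‖s - β‖ := by
        have h1 : |(s - β).im| ≤ ‖s - (β : ℂ)‖ := Complex.abs_im_le_norm _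
        have h2 : (s - (β : ℂ)).im = 2 * t := by simp [hsim]
        rw [h2, abs_mul, abs_of_pos (by norm_num : (0:ℝ) < 2)] at h1
        exact h1
      have hinv : ‖s - (β : ℂ)‖⁻¹ ≤ 1 / M :=
        le_trans (inv_anti₀ (by positivity) hdist) htM
      calc C * ((Real.log q + Real.log (|s.im| + 4)) + ‖s - (β : ℂ)‖⁻¹)
          ≤ C * (4 * (1 / M) + 1 / M) := by
            refine mul_le_mul_of_nonneg_left ?_ hC.le
            linarith
        _ = 5 * C / M := by field_simp; ring
    · push Not at hex
      obtain ⟨hne, hle⟩ := hA q χ hχ (fun β hβ => hex β hβ) s hreg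
      refine ⟨hne, le_trans hle ?_⟩
      calc C * (Real.log q + Real.log (|s.im| + 4)) ≤ C * (4 * (1 / M)) := by
            refine mul_le_mul_of_nonneg_left ?_ hC.le
            linarith
        _ ≤ 5 * C / M := by
            have h1 : C * (4 * (1 / M)) = 4 * C / M := by ring
            rw [h1]
            exact div_le_div_of_nonneg_right (by nlinarith) hMpos.le
  obtain ⟨hne, hle⟩ := key
  have hnorm : 0 < ‖χ.LFunction s‖ := norm_pos_iff.mpr hne
  rw [norm_inv] at hle
  have := inv_le_of_inv_le₀ hnorm hle
  calc (5 * C)⁻¹ * M = (5 * C / M)⁻¹ := by field_simp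
    _ ≤ ‖χ.LFunction s‖ := this

end Literature.NumberTheory.LFunctions.SiegelPoint

end
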